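import Summits.Ventures.PercRepro.RankLevelSetIndepSRI
import Summits.Ventures.PercRepro.RankLevelSetBiIndepTruncate

/-! # RankLevelSetIndepSRITruncate — THE (SRI)-CLASS IS CLOSED UNDER TRUNCATION (night-1 g28; dossier §40)

For the truncation `truncateTo M k` (independent = independent in `M` of size `≤ k`) the `(y, e)`-slices
`I_p^A = sliceCount M y e A p = #{T ⊆ E ∖ {y, e} : #T = p, T ∪ A independent}` (`A ⊆ {y, e}`) are windows of those
of `M`: `I_p^A(T_k M) = I_p^A(M)` for `p + #A ≤ k` and `0` beyond (`sliceCount_truncateTo`). Hence (SRI) at level `p`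
for the truncation is (SRI) for `M` when `p + 2 ≤ k`, and trivial (`I_p^{ye} = 0`) otherwise:
**`indepSRI_truncateTo : IndepSRI M → IndepSRI (truncateTo M k)`** — the (SRI)-class is closed under truncation, as
the (CD)-class is (`RankLevelSetIndepCDTruncate`). Every declaration has a docstring; imports: the cell's own modules
and Mathlib only. Axioms: standard. -/

namespace PercRepro

open Set Matroid

variable {α : Type} (M : Matroid α) [M.Finite]

/-- **The slices of the truncation are windows**: for `A ⊆ {y, e}`, `I_p^A(T_k M) = I_p^A(M)` if `p + #A ≤ k`, else `0`. -/
lemma sliceCount_truncateTo (y e : α) {A : Set α} (hA : A ⊆ {y, e}) (k p : ℕ) :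
    haveI := truncateTo_finite M k
    sliceCount (truncateTo M k) y e A p = if p + A.ncard ≤ k then sliceCount M y e A p else 0 := by
  haveI := truncateTo_finite M k
  have hE' : (M.E \ {y, e}).Finite := M.ground_finite.subset Set.sdiff_subset
  have hAfin : A.Finite := (Set.toFinite {y, e}).subset hA
  have hcard : ∀ T : Set α, T ⊆ M.E \ {y, e} → T.ncard = p → (T ∪ A).ncard = p + A.ncard := by
    intro T hTE hT
    have hdisj : Disjoint T A := by
      rw [Set.disjoint_left]
      intro x hxT hxA
      exact (hTE hxT).2 (hA hxA)
    rw [Set.ncard_union_eq hdisj (hE'.subset hTE) hAfin, hT]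
  unfold sliceCount
  simp only [truncateTo_E, truncateTo_indep_iff]
  split_ifs with hpk
  · congr 1
    ext T
    simp only [Set.mem_setOf_eq]
    constructor
    · rintro ⟨hTE, hT, hind, -⟩; exact ⟨hTE, hT, hind⟩
    · rintro ⟨hTE, hT, hind⟩
      exact ⟨hTE, hT, hind, by rw [hcard T hTE hT]; exact hpk⟩
  · rw [Set.ncard_eq_zero (hE'.finite_subsets.subset (fun T hT => hT.1))]
    ext T
    simp only [Set.mem_setOf_eq, Set.mem_empty_iff_false, iff_false, not_and]
    intro hTE hT _ hle
    rw [hcard T hTE hT] at hle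
    exact hpk hle

/-- **THE (SRI)-CLASS IS CLOSED UNDER TRUNCATION**: `IndepSRI M → IndepSRI (truncateTo M k)`. -/
theorem indepSRI_truncateTo (h : IndepSRI M) (k : ℕ) :
    haveI := truncateTo_finite M k
    IndepSRI (truncateTo M k) := by
  haveI := truncateTo_finite M k
  intro y hy e he hye p
  rw [truncateTo_E] at hy he
  rw [sliceCount_truncateTo M y e (Set.empty_subset _), sliceCount_truncateTo M y e (subset_refl _),
    sliceCount_truncateTo M y e (Set.singleton_subset_iff.mpr (by simp)),
    sliceCount_truncateTo M y e (Set.singleton_subset_iff.mpr (by simp)), Set.ncard_empty, Set.ncard_pair hye,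
    Set.ncard_singleton, Set.ncard_singleton]
  by_cases hpk : p + 2 ≤ k
  · rw [if_pos (by omega), if_pos hpk, if_pos (by omega), if_pos (by omega)]
    exact h y hy e he hye p
  · rw [if_neg hpk, mul_zero]
    exact Nat.zero_le _

end PercRepro
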